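import Mathlib

/-!
# SoloBlind — the flat zero-bounded lobe in degree 3 (certificate for K⁺, n = 3, family (a))

Solo/blind artefact (unit `solo-RiemannHypothesis-blind`, claims C78/C81).  An EXTREMAL-PROBLEM statement
about non-negative trigonometric polynomials; it has no bearing on `RiemannHypothesis` itself.

CONJECTURE K⁺ (window-height notes §12.10.3(l)): for every non-negative trigonometric polynomial `T` of
degree `≤ n`, the sum of `T` over its local maxima is at most `2n · mean(T)`.  For `n = 3` the proof in the
notes reduces, after a variational argument, to value bounds on a handful of explicit RIGID families.  The
binding one is family (a): `T(θ) = |(z − e^{iα})(z − e^{−iα})(z − b)|²`, `z = e^{iθ}`, `b > 0`, with a FLAT top at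
`θ = 0`.  Writing `c = cos α`:

* `mean(T) = ‖g‖² = 1 + b² + (b + 2c)² + (1 + 2bc)²` for `g(z) = (z² − 2cz + 1)(z − b) = z³ − (b+2c)z² + (1+2bc)z − b`
  (Parseval);
* `T(0) = |g(1)|² = 4(1−c)²(1−b)²`, `T(π) = |g(−1)|² = 4(1+c)²(1+b)²`;
* the flat-top condition `T″(0) = 0` is `8(1−c)[(1−c)b − (1−b)²] = 0`, i.e. (for `c ≠ 1`) `c·b = b − (1−b)²`
  (derived by hand in the notes; it is the HYPOTHESIS `h` below, not re-derived here);
* the flat top is counted twice (virtual count of a maximum of `T′`-multiplicity 3) and the only other local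
  maximum sits at `θ = π`, so the quantity to bound is `Ψ = 2·T(0) + T(π)` against `6 · mean(T)`.

THIS FILE CERTIFIES, for all real `b > 0` and `c` with `c·b = b − (1−b)²`:
`2·T(0) + T(π) < 6 · mean(T)` — i.e. the flat double-counted lobe never reaches the comb value `2n = 6`
(numerically the family's supremum is `5.1914`, at `b ≈ 0.3357`).  The proof is the polynomial identity
`b²(6·mean − Ψ) = 4·(3(b−1)⁶ − 15 b²(b−1)² + 14 b³)` on the flat-top relation, and the positivity
`3(b−1)⁶ − 15b²(b−1)² + 14b³ = 3u(u − 13b/10)² + b(78u² − (2007/10)ub + 140b²)/10 > 0` (`u = (b−1)²`).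
Also recorded: the closed forms `b²Ψ = 12 − 72b + 132b² − 80b³ + 132b⁴ − 72b⁵ + 12b⁶`,
`b²·mean = 4 − 24b + 42b² − 24b³ + 42b⁴ − 24b⁵ + 4b⁶` (palindromic: `b ↔ 1/b`), and the elementary values of the
other rigid families quoted in the notes (`16/5 < 4` for n = 2; `48/11 < 6` and `3 + c/(12C) ≤ 4` for n = 3).
-/

namespace Summit.RiemannHypothesis.RiemannHypothesis.Theorems

noncomputable section

/-- `mean(T) = ‖g‖²` for `g(z) = z³ − (b+2c)z² + (1+2bc)z − b`. -/
def soloBlindFlatMean (b c : ℝ) : ℝ := 1 + b^2 + (b + 2*c)^2 + (1 + 2*b*c)^2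

/-- `T(0) = |g(1)|²` (the flat top). -/
def soloBlindFlatTop (b c : ℝ) : ℝ := 4*(1 - c)^2*(1 - b)^2

/-- `T(π) = |g(−1)|²` (the other local maximum). -/
def soloBlindFlatFar (b c : ℝ) : ℝ := 4*(1 + c)^2*(1 + b)^2

/-- The double-counted value `Ψ = 2·T(0) + T(π)`. -/
def soloBlindFlatPsi (b c : ℝ) : ℝ := 2 * soloBlindFlatTop b c + soloBlindFlatFar b c

/-- The positivity polynomial: `P₄(b) = 3(b−1)⁶ − 15 b²(b−1)² + 14 b³ > 0` for `b > 0`. -/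
theorem soloBlind_flatP4_pos (b : ℝ) (hb : 0 < b) :
    0 < 3*(b - 1)^6 - 15*b^2*(b - 1)^2 + 14*b^3 := by
  have key : 3*(b - 1)^6 - 15*b^2*(b - 1)^2 + 14*b^3
      = 3*(b - 1)^2*((b - 1)^2 - 13/10*b)^2
        + b*((78*((b - 1)^2)^2 - 2007/10*(b - 1)^2*b + 140*b^2)/10) := by ring
  have q1 : 0 ≤ 3*(b - 1)^2*((b - 1)^2 - 13/10*b)^2 := by positivity
  have q2 : 0 < 78*((b - 1)^2)^2 - 2007/10*(b - 1)^2*b + 140*b^2 := by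
    nlinarith [sq_nonneg ((b - 1)^2 - 1287/1000*b), sq_nonneg (b - 1), mul_pos hb hb]
  have q3 : 0 < b*((78*((b - 1)^2)^2 - 2007/10*(b - 1)^2*b + 140*b^2)/10) := by
    apply mul_pos hb; linarith
  linarith [key, q1, q3]

/-- The identity on the flat-top relation: `b²(6·mean − Ψ) = 4·P₄(b)`. -/
theorem soloBlind_flat_identity (b c : ℝ) (h : c*b = b - (1 - b)^2) :
    b^2 * (6 * soloBlindFlatMean b c - soloBlindFlatPsi b c)
      = 4 * (3*(b - 1)^6 - 15*b^2*(b - 1)^2 + 14*b^3) := by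
  unfold soloBlindFlatPsi soloBlindFlatMean soloBlindFlatTop soloBlindFlatFar
  linear_combination ((12*b + 8*b^2 + 12*b^3)*c + (-12 + 36*b + 36*b^3 - 12*b^4)) * h

/-- Closed form of `b²·Ψ` on the flat-top relation (palindromic sextic). -/
theorem soloBlind_flat_psi_closed (b c : ℝ) (h : c*b = b - (1 - b)^2) :
    b^2 * soloBlindFlatPsi b c = 12 - 72*b + 132*b^2 - 80*b^3 + 132*b^4 - 72*b^5 + 12*b^6 := by
  unfold soloBlindFlatPsi soloBlindFlatTop soloBlindFlatFar
  linear_combination ((12*b - 8*b^2 + 12*b^3)*c + (-12 + 36*b + 36*b^3 - 12*b^4)) * h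

/-- Closed form of `b²·mean` on the flat-top relation (palindromic sextic). -/
theorem soloBlind_flat_mean_closed (b c : ℝ) (h : c*b = b - (1 - b)^2) :
    b^2 * soloBlindFlatMean b c = 4 - 24*b + 42*b^2 - 24*b^3 + 42*b^4 - 24*b^5 + 4*b^6 := by
  unfold soloBlindFlatMean
  linear_combination ((4*b + 4*b^3)*c + (-4 + 12*b + 12*b^3 - 4*b^4)) * h

/-- THE VALUE BOUND for family (a): the flat double-counted lobe stays strictly below `2n·mean = 6·mean`. -/
theorem soloBlind_flat_value_bound (b c : ℝ) (hb : 0 < b) (h : c*b = b - (1 - b)^2) :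
    soloBlindFlatPsi b c < 6 * soloBlindFlatMean b c := by
  have hid := soloBlind_flat_identity b c h
  have hP := soloBlind_flatP4_pos b hb
  have hprod : 0 < b^2 * (6 * soloBlindFlatMean b c - soloBlindFlatPsi b c) := by
    rw [hid]; linarith
  have hb2 : 0 ≤ b^2 := by positivity
  have := pos_of_mul_pos_right hprod hb2
  linarith

/-- Ratio form: `Ψ / mean < 6` (the mean is `≥ 1 > 0`). -/
theorem soloBlind_flat_ratio_bound (b c : ℝ) (hb : 0 < b) (h : c*b = b - (1 - b)^2) :
    soloBlindFlatPsi b c / soloBlindFlatMean b c < 6 := by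
  have hm : 0 < soloBlindFlatMean b c := by unfold soloBlindFlatMean; positivity
  rw [div_lt_iff₀ hm]
  linarith [soloBlind_flat_value_bound b c hb h]

/-- The admissible range: `|c| ≤ 1` together with the flat-top relation forces `b² − 4b + 1 ≤ 0`
(i.e. `2 − √3 ≤ b ≤ 2 + √3`); recorded as the inequality actually used. -/
theorem soloBlind_flat_range (b c : ℝ) (hb : 0 < b) (h : c*b = b - (1 - b)^2) (hc : -1 ≤ c) :
    b^2 - 4*b + 1 ≤ 0 := by nlinarith

/-- n = 2, the only over-budget structure: `T = c(1 − sin⁴((θ−x)/2))`, `Ψ/mean = 2/(1 − 3/8) = 16/5 < 4`. -/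
theorem soloBlind_rigid_n2 : (2 : ℝ) / (1 - 3/8) = 16/5 ∧ (16 : ℝ)/5 < 4 := by norm_num

/-- n = 3, family (c): `T = c(1 − sin⁶((θ−x)/2))`, `Ψ/mean = 3/(1 − 5/16) = 48/11 < 6`. -/
theorem soloBlind_rigid_n3c : (3 : ℝ) / (1 - 5/16) = 48/11 ∧ (48 : ℝ)/11 < 6 := by norm_num

/-- n = 3, family (d): `T′ ∝ sin³θ`, `Ψ = 3C + c/12` with `mean = C ≥ c/12`: `Ψ ≤ 4·mean < 6·mean`. -/
theorem soloBlind_rigid_n3d (C c : ℝ) (hC : 0 < C) (h : c/12 ≤ C) :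
    3*C + c/12 ≤ 4*C ∧ 4*C < 6*C := by constructor <;> linarith

end

end Summit.RiemannHypothesis.RiemannHypothesis.Theorems
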